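import Summits.BirchSwinnertonDyer.BirchSwinnertonDyer.Theorems.TwoAdicConverseGoodTwistsGoldfeld
import Summits.BirchSwinnertonDyer.BirchSwinnertonDyer.Theorems.TwoAdicConverseGoodTwistsMult
import HarnessLib

/-!
# Route `TwoAdicConverse` (rung S3): the RUNG LEAF `NonCMTwoConverse` ⟹ rank BSD for `100 %` of the
# good twists and Goldfeld `50 / 50`, for EVERY non-CM curve good ordinary OR multiplicative at `2`

Cell `bsd-2adic` (run/shared/lean/pub/bsd-2adic/), seat `bsd-2adic-conv-1`. THEOREMS ONLY — nothing
asserted, no definition, no named fact introduced. The two branch files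
(`TwoAdicConverseGoodTwistsGoldfeld`, good ordinary at `2`, p419791; `TwoAdicConverseGoodTwistsMult`,
multiplicative at `2`, p419742) assembled over the leaf's full hypothesis `GoodOrd W 2 ∨ Mult W 2`:
LADDER-BSD §1 row S3's head line — «rank-`0`/`1` `2`-adic p-converse for non-CM `E` with good-ordinary
/ multiplicative `2` ⟹ (Smith 2025) BSD-rank + Goldfeld for `100 %` of good-at-`2` twists of EVERY such
`E`» — as ONE kernel theorem modulo named facts: the leaf
`Summit.BirchSwinnertonDyer.BirchSwinnertonDyer.Rank1Residual.NonCMTwoConverse` (OPEN; = the route's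
deciding theorem `closes` fed with its items), Gross–Zagier–Kolyvagin (`hGZK`), Modularity
(`hmod : exists_isNewformOf`, root-number equidistribution and `(−1)^{r_an} = w`), and Smith's
Thm. 1.1 for `W` (`hS : smith_selmerCorank_density W`, arXiv:2503.17619).

Here «good twists» = the family `𝓕 = {d squarefree : d ≡ 1 (mod 4)}` (the twists unramified at `2`,
so that `W^{(d)}` stays non-CM and good ordinary, resp. multiplicative, at `2` — both closure lemmas
are PROVED in the branch files), densities are relative densities in `𝓕` ordered by `|d|`, and
«rank BSD» = `ord_{s=1} L(W^{(d)}, s) = rank W^{(d)}(ℚ)` with `Ш(W^{(d)}/ℚ)` finite.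

HONEST FRAMING: nothing here proves the leaf or BSD; the leaf is the conjunction of three OPEN
cruxes (19218/19151, 19219/19187, residual 19220). Says nothing about `d ≢ 1 (mod 4)` (additive `2`:
no door, I2) nor about CM curves (rungs S1/S2) nor about supersingular `2`. PARTITION (D-0054): none —
RANK axis (S3); companion formula cells X5@2 good-ord (611) and mult (1 976 book230 classes), owner
bsd-2adic. References: [arXiv250317619] Thm. 1.1, Cor. 1.2–1.3; [MurtyMurty1997] Ch. 6 §1;
[GreenbergLNM1716] §1; [SilvermanAEC2009] VII.5.1, X.5.4.
-/

set_option linter.dupNamespace false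
set_option autoImplicit false

noncomputable section

open scoped Classical

open Filter Topology WeierstrassCurve Literature.NumberTheory.EllipticCurves
  Literature.NumberTheory.EllipticCurves.ModularForms
  Literature.NumberTheory.EllipticCurves.Rank1Residual
  Summit.BirchSwinnertonDyer.BirchSwinnertonDyer.Theses.TwoAdicConverse

namespace Summit.BirchSwinnertonDyer.BirchSwinnertonDyer.Theorems.TwoAdicGoodTwists

/-- **THE RUNG'S HEAD LINE (LADDER-BSD §1 row S3) over the leaf's full hypothesis.** The leaf S3
`NonCMTwoConverse`, Gross–Zagier–Kolyvagin, Modularity and Smith's Thm. 1.1 for `W` give, for EVERY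
globally minimal NON-CM elliptic `W / ℚ` that is good ORDINARY or MULTIPLICATIVE at `2`:
(1) rank BSD (`ord_{s=1} L(W^{(d)}, s) = rank W^{(d)}(ℚ)`, `Ш(W^{(d)}/ℚ)` finite) for `100 %` of the
good twists `d ∈ 𝓕`; (2) `ord L = rank = 0 ∧ Ш` finite for exactly `50 %` of `d ∈ 𝓕`; (3)
`ord L = rank = 1 ∧ Ш` finite for exactly `50 %` of `d ∈ 𝓕` (Goldfeld's conjecture for `W` on `𝓕`,
with BSD). By cases on the reduction type at `2` (`bsdRank_and_goldfeld_goodTwists_of_nonCMTwoConverse`,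
`bsdRank_and_goldfeld_goodTwists_mult_of_nonCMTwoConverse`).
[cite: arXiv250317619, Thm. 1.1 and Cor. 1.2] [cite: MurtyMurty1997, Ch. 6 §1] -/
theorem bsdRank_and_goldfeld_goodTwists_of_nonCMTwoConverse_leaf
    (hS3 : Summit.BirchSwinnertonDyer.BirchSwinnertonDyer.Rank1Residual.NonCMTwoConverse)
    (hGZK : rank_eq_analyticRank_of_analyticRank_le_one) (hmod : exists_isNewformOf)
    (W : WeierstrassCurve ℚ) [W.IsElliptic] [W.IsGloballyMinimal] (hCM : ¬ W.HasCM)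
    (hred : GoodOrd W 2 ∨ Mult W 2) (hS : smith_selmerCorank_density W) :
    Tendsto (fun X : ℕ ↦ (Nat.card {d : ℤ | Squarefree d ∧ |d| ≤ (X : ℤ) ∧ (d % 4 = 1 ∧
        ((W.quadraticTwist d).analyticRank = (W.quadraticTwist d).mordellWeilRank ∧
          Finite (W.quadraticTwist d).sha))} : ℝ) /
      Nat.card {d : ℤ | Squarefree d ∧ |d| ≤ (X : ℤ) ∧ d % 4 = 1}) atTop (𝓝 1) ∧
    Tendsto (fun X : ℕ ↦ (Nat.card {d : ℤ | Squarefree d ∧ |d| ≤ (X : ℤ) ∧ (d % 4 = 1 ∧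
        ((W.quadraticTwist d).analyticRank = 0 ∧ (W.quadraticTwist d).mordellWeilRank = 0 ∧
          Finite (W.quadraticTwist d).sha))} : ℝ) /
      Nat.card {d : ℤ | Squarefree d ∧ |d| ≤ (X : ℤ) ∧ d % 4 = 1}) atTop (𝓝 (1 / 2)) ∧
    Tendsto (fun X : ℕ ↦ (Nat.card {d : ℤ | Squarefree d ∧ |d| ≤ (X : ℤ) ∧ (d % 4 = 1 ∧
        ((W.quadraticTwist d).analyticRank = 1 ∧ (W.quadraticTwist d).mordellWeilRank = 1 ∧
          Finite (W.quadraticTwist d).sha))} : ℝ) /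
      Nat.card {d : ℤ | Squarefree d ∧ |d| ≤ (X : ℤ) ∧ d % 4 = 1}) atTop (𝓝 (1 / 2)) := by
  rcases hred with hgo | hm
  · exact bsdRank_and_goldfeld_goodTwists_of_nonCMTwoConverse W hS3 hGZK hmod hCM hgo hS
  · exact bsdRank_and_goldfeld_goodTwists_mult_of_nonCMTwoConverse W hS3 hGZK hmod hCM hm hS

/-- **Absolute form: for `100 %` of ALL squarefree `d` (Smith's normalisation), `d ≡ 1 (mod 4)` ⟹
rank BSD for `W^{(d)}`**, for every globally minimal non-CM `W` good ordinary or multiplicative at `2`,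
from the leaf, GZK and Smith's Thm. 1.1 (no Modularity needed: no root numbers).
[cite: arXiv250317619, Thm. 1.1 and Cor. 1.2] -/
theorem twistDensity_bsdRank_of_emod_four_eq_one_of_nonCMTwoConverse_leaf
    (hS3 : Summit.BirchSwinnertonDyer.BirchSwinnertonDyer.Rank1Residual.NonCMTwoConverse)
    (hGZK : rank_eq_analyticRank_of_analyticRank_le_one)
    (W : WeierstrassCurve ℚ) [W.IsElliptic] [W.IsGloballyMinimal] (hCM : ¬ W.HasCM)
    (hred : GoodOrd W 2 ∨ Mult W 2) (hS : smith_selmerCorank_density W) :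
    twistDensity (fun d ↦ d % 4 = 1 →
      (W.quadraticTwist d).analyticRank = (W.quadraticTwist d).mordellWeilRank ∧
        Finite (W.quadraticTwist d).sha) 1 := by
  have hConv : GoodOrdinaryRankZeroTwoConverse :=
    fun V _ _ hcm hgo' h0 ↦ hS3 V hcm (Or.inl hgo') 0 (Nat.zero_le 1) h0
  have hConvM : MultiplicativeRankZeroTwoConverse :=
    fun V _ _ hcm hm' h0 ↦ hS3 V hcm (Or.inr hm') 0 (Nat.zero_le 1) h0
  have hR1 : RankOneTwoConverse := fun V _ _ hcm hred' h1 ↦ hS3 V hcm hred' 1 le_rfl h1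
  refine twistDensity_one_mono (fun d _ hRd hd4 ↦ ?_) (twistDensity_selmerCorankTwoInfty_le_one_of W hS)
  rcases hred with hgo | hm
  · obtain ⟨har, hrank, hsha⟩ :=
      bsdRank_quadraticTwist_of_selmerCorankTwoInfty_le_one hConv hR1 hGZK W hCM hgo hd4 hRd.2
    exact ⟨har.trans hrank.symm, hsha⟩
  · obtain ⟨har, hrank, hsha⟩ :=
      bsdRank_quadraticTwist_mult_of_selmerCorankTwoInfty_le_one hConvM hR1 hGZK W hCM hm hd4 hRd.2
    exact ⟨har.trans hrank.symm, hsha⟩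

end Summit.BirchSwinnertonDyer.BirchSwinnertonDyer.Theorems.TwoAdicGoodTwists

end
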